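import Literature.AnabelianGeometry.SemiGraphs.TemperedCurveGaloisInfinite
import Literature.AnabelianGeometry.AbsoluteAnabelian.GaloisCyclotomeOpenSubgroupAction
import Literature.AnabelianGeometry.AbsoluteAnabelian.GaloisCyclotomeZHatOne
import Literature.NumberTheory.GaloisRepresentations.LocalFieldPadicProofs
import HarnessLib

/-!
# The group-theoretic cyclotome `μ_Ẑ(G_K)` of a tempered curve's base Galois group IS `Ẑ(1) = Λ(ℚ̄_pˣ)`,
# `G_K`-equivariantly (proof-only junction: [AbsTopIII] Cor. 1.10 (i)(a) at the [SemiAnbd] §6 / [EtTh] §1 `G_K`)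

Mochizuki, *Topics in Absolute Anabelian Geometry III*, §1, Cor. 1.10 (i)(a) p. 42 («`μ_Ẑ(G_k) := Hom(ℚ/ℤ, μ_{ℚ/ℤ}(G_k))`»,
«unaffected by the operation of passing from `G_k` to an open subgroup») [cite: MochizukiAbsTopIII2015, Cor 1.10 (i) p.42];
*The absolute anabelian geometry of hyperbolic curves* (2004), Prop. 1.2.1 (vi) p. 10 («Galois-equivariant»); *Semi-graphs of
anabelioids* (2006) §6 p. 69 («`G_K := Gal(K̄/K)`») [cite: MochizukiSemiAnbd2006, §6 p.69].

JUNCTION (abc-iut cell; seat abc-iut-w5-d145, for GAP-LEDGER G-w5d145-1 = the (E′) half of the `Π`-side of [IUTchII]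
Cor. 1.11 at Cor. 1.10's genuine family). The tree's tempered-curve interface `SemiGraphs.TemperedCurve p` (over which the
[EtTh] §1 `ThetaSetting` is built) has base Galois group `X.GK = K.fixingSubgroup ≤ G_{ℚ_p} = Gal(ℚ̄_p/ℚ_p)` for a FINITE
extension `K ⊆ ℚ̄_p = AlgebraicClosure ℚ_[p]` — a GENUINE Galois group. abc-iut-L4's local class field theory
(`exists_muZhat_mulEquiv_cyclotome_units`, `GaloisCyclotomeZHatOne`; `nonempty_torsionReciprocityData`) identifies the
group-theoretic cyclotome `μ_Ẑ(Gal(k̄/k))` of `Field.absoluteGaloisGroup k` with `Λ(k̄ˣ)` equivariantly for every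
characteristic-`0` non-archimedean local field `k`; the tree proves `ℚ_[p]` is one
(`Padic.isNonarchimedeanLocalField_holds`), and `Field.absoluteGaloisGroup ℚ_[p]` IS `G_{ℚ_p}`. This file transports that
identification to the OPEN subgroup `G_K ≤ G_{ℚ_p}` along abc-iut-L4-t17's open-subgroup invariance
`muZhat.restrictOpenEquiv` with its `G_K`-equivariance (`muZhat.restrictOpenEquiv_smul`, `GaloisCyclotomeOpenSubgroupAction`):
* `TemperedCurve.isOpen_GK`, `t2Space_GK` — `G_K` is an open, Hausdorff subgroup of the profinite `G_{ℚ_p}` (`K/ℚ_p` finite;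
  compactness is abc-iut's `TemperedCurve.compactSpace_GK`, `TemperedCurveGaloisInfinite`; `G_{ℚ_p}` compact/Hausdorff =
  the tree's `SettingModel.compactSpace_GQp` / `ThetaSetting.t2Space_GQp`, used here only as local instances);
* **`TemperedCurve.exists_muZhat_GK_mulEquiv_cyclotome`** — `∃ f : μ_Ẑ(G_K) ⥲ Λ(ℚ̄_pˣ)` with
  `f (g • ζ)_n = g (f ζ)_n` for all `g ∈ G_K`: the INTRINSIC `G_K`-module `μ_Ẑ(G_K)` (conjugation action on
  `lim_U (U^ab)_tors`) is `Ẑ(1)` with the cyclotomic (field) action — unconditionally.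
Proof-only (no definitions); classical local class field theory as proved in the tree; nothing here bears on [IUTchIII]
Cor. 3.12.
-/

noncomputable section

namespace Literature.AnabelianGeometry.SemiGraphs.TemperedCurve

open Literature.AnabelianGeometry.AbsoluteAnabelian

variable {p : ℕ} [Fact p.Prime] (X : TemperedCurve p)

/-- `G_K` is open in `G_{ℚ_p}` (`K/ℚ_p` is finite: the fixing subgroup of a finite-dimensional intermediate field is open
in the Krull topology). [cite: MochizukiSemiAnbd2006, §6 p.69] -/
theorem isOpen_GK : IsOpen (X.GK : Set (GQp p)) := by
  haveI := X.finiteDimensional_K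
  exact X.K.fixingSubgroup_isOpen

/-- `G_K` is Hausdorff. [cite: MochizukiSemiAnbd2006, §6 p.69] -/
theorem t2Space_GK : T2Space X.GK := by
  haveI : T2Space (GQp p) := krullTopology_t2
  infer_instance

/-- **`μ_Ẑ(G_K) ≅ Ẑ(1) = Λ(ℚ̄_pˣ)`, `G_K`-equivariantly** ([AbsTopIII] Cor. 1.10 (i)(a) + [AbsAnab] Prop. 1.2.1 (vi), AT the
genuine base Galois group of a tempered curve): there is an isomorphism of the GROUP-THEORETIC cyclotome
`μ_Ẑ(G_K) = Hom(ℚ/ℤ, lim_{U ≤ G_K open} (U^ab)_tors)` (with its intrinsic conjugation action of `G_K`) onto the compatible systems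
of roots of unity of `ℚ̄_p` on which `g ∈ G_K ≤ Gal(ℚ̄_p/ℚ_p)` acts by the field action — i.e. the conjugation action IS the
cyclotomic character. From abc-iut-L4's `exists_muZhat_mulEquiv_cyclotome_units ℚ_[p]` (local class field theory,
`Padic.isNonarchimedeanLocalField_holds`) and the `G_K`-equivariant open-subgroup invariance `μ_Ẑ(G_K) ≅ μ_Ẑ(G_{ℚ_p})`.
[cite: MochizukiAbsTopIII2015, Cor 1.10 (i) p.42] -/
theorem exists_muZhat_GK_mulEquiv_cyclotome [CompactSpace X.GK] :
    ∃ f : muZhat X.GK ≃* EtaleTheta.cyclotome (AlgebraicClosure ℚ_[p])ˣ,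
      ∀ (g : X.GK) (ζ : muZhat X.GK) (n : ℕ+),
        ((((f (g • ζ) : EtaleTheta.cyclotome (AlgebraicClosure ℚ_[p])ˣ) : ℕ+ → (AlgebraicClosure ℚ_[p])ˣ) n :
            (AlgebraicClosure ℚ_[p])ˣ) : AlgebraicClosure ℚ_[p]) =
          (g : GQp p) ((((f ζ : EtaleTheta.cyclotome (AlgebraicClosure ℚ_[p])ˣ) : ℕ+ → (AlgebraicClosure ℚ_[p])ˣ) n :
            (AlgebraicClosure ℚ_[p])ˣ) : AlgebraicClosure ℚ_[p]) := by
  haveI : CompactSpace (GQp p) := inferInstanceAs (CompactSpace (Field.absoluteGaloisGroup ℚ_[p]))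
  haveI : IsNonarchimedeanLocalField ℚ_[p] :=
    Literature.NumberTheory.GaloisRepresentations.Padic.isNonarchimedeanLocalField_holds p
  let H : OpenSubgroup (GQp p) := ⟨X.GK, X.isOpen_GK⟩
  obtain ⟨e, he⟩ := exists_muZhat_mulEquiv_cyclotome_units ℚ_[p]
  refine ⟨(muZhat.restrictOpenEquiv H).trans e, fun g ζ n => ?_⟩
  rw [MulEquiv.trans_apply, MulEquiv.trans_apply, muZhat.restrictOpenEquiv_smul H g ζ]
  exact he (g : GQp p) _ n

end Literature.AnabelianGeometry.SemiGraphs.TemperedCurve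

end
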